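import Mathlib
import Summits.CriticalPhenomena.CardyFormulaZ2.Theorems.CardySelfRefinementRussoDriftPolynomial
import HarnessLib

/-!
# Crux `GradientComparability` (stmt-CriticalPhenomena-10269), line `Sketch`:
# stub `stub_comparability_fixedMesh` — comparability at a FIXED mesh is automatic

Route `CardySelfRefinement`, sub-problem `CriticalPhenomena/CardyFormulaZ2`; vocabulary
(`P`, `Dρ`, `Dc`, …) from `CardySelfRefinementDefs`.

Mathematics.  At a fixed mesh `η ≠ 0` the joint crossing probability `(ρ, c) ↦ P k m F η ρ c` is a
polynomial on `[0,1]²`: by `exists_contDiff_eq_P` there is a `C¹` function `Φ : ℝ² → ℝ` agreeing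
with it on the square.  Since `[0,1]` has unique one-sided derivatives, the Russo derivatives
`Dρ`, `Dc` (`derivWithin` on `Icc 0 1`) are the partial derivatives `fderiv ℝ Φ q (1,0)` and
`fderiv ℝ Φ q (0,1)` of `Φ` at every point `q` of the square (`derivWithin_eq_fderiv_fst`,
`derivWithin_eq_fderiv_snd`), so the gradient size `|Dρ| + |Dc|` agrees on the square with the
continuous function `q ↦ |fderiv ℝ Φ q (1,0)| + |fderiv ℝ Φ q (0,1)|`.  Along a continuous path
`γ : [0,1] → [0,1]²` it is therefore a continuous function on a nonempty compact space; if it is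
positive along the path it attains a positive minimum `G_min` and a maximum `G_max`, and
`Λ := G_max / G_min` compares any two path points (`stub_comparability_fixedMesh`).  All the content
of clause (i) of the crux is thus the uniformity of `Λ` as `η → 0`.
-/

noncomputable section

namespace Summit.CriticalPhenomena.CardyFormulaZ2.Theorems.CardySelfRefinement

open scoped Topology
open Filter Set MeasureTheory
open Literature.Probability.LatticeModels Literature.Probability.Percolation
open Literature.Probability.Percolation.QuadCrossing
open Summit.CriticalPhenomena.CardyFormulaZ2.Theses.CardySelfRefinement

/-- If `Φ : ℝ² → ℝ` is differentiable at `(ρ, c)` and `f` agrees with `ρ' ↦ Φ (ρ', c)` on `[0,1]`,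
then for `ρ ∈ [0,1]` the one-sided derivative of `f` within `[0,1]` at `ρ` is the partial
derivative `fderiv ℝ Φ (ρ, c) (1, 0)`. -/
theorem derivWithin_eq_fderiv_fst {Φ : ℝ × ℝ → ℝ} {f : ℝ → ℝ} {ρ c : ℝ}
    (hΦ : DifferentiableAt ℝ Φ (ρ, c)) (hρ : ρ ∈ Set.Icc (0 : ℝ) 1)
    (hf : Set.EqOn f (fun ρ' => Φ (ρ', c)) (Set.Icc (0 : ℝ) 1)) :
    derivWithin f (Set.Icc (0 : ℝ) 1) ρ = fderiv ℝ Φ (ρ, c) (1, 0) := by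
  have hcurve : HasDerivAt (fun ρ' : ℝ => (ρ', c)) ((1 : ℝ), (0 : ℝ)) ρ :=
    (hasDerivAt_id ρ).prodMk (hasDerivAt_const ρ c)
  have hd : HasDerivAt (fun ρ' : ℝ => Φ (ρ', c)) (fderiv ℝ Φ (ρ, c) (1, 0)) ρ :=
    hΦ.hasFDerivAt.comp_hasDerivAt ρ hcurve
  rw [derivWithin_congr hf (hf hρ)]
  exact hd.hasDerivWithinAt.derivWithin (uniqueDiffOn_Icc zero_lt_one ρ hρ)

/-- If `Φ : ℝ² → ℝ` is differentiable at `(ρ, c)` and `f` agrees with `c' ↦ Φ (ρ, c')` on `[0,1]`,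
then for `c ∈ [0,1]` the one-sided derivative of `f` within `[0,1]` at `c` is the partial
derivative `fderiv ℝ Φ (ρ, c) (0, 1)`. -/
theorem derivWithin_eq_fderiv_snd {Φ : ℝ × ℝ → ℝ} {f : ℝ → ℝ} {ρ c : ℝ}
    (hΦ : DifferentiableAt ℝ Φ (ρ, c)) (hc : c ∈ Set.Icc (0 : ℝ) 1)
    (hf : Set.EqOn f (fun c' => Φ (ρ, c')) (Set.Icc (0 : ℝ) 1)) :
    derivWithin f (Set.Icc (0 : ℝ) 1) c = fderiv ℝ Φ (ρ, c) (0, 1) := by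
  have hcurve : HasDerivAt (fun c' : ℝ => (ρ, c')) ((0 : ℝ), (1 : ℝ)) c :=
    (hasDerivAt_const c ρ).prodMk (hasDerivAt_id c)
  have hd : HasDerivAt (fun c' : ℝ => Φ (ρ, c')) (fderiv ℝ Φ (ρ, c) (0, 1)) c :=
    hΦ.hasFDerivAt.comp_hasDerivAt c hcurve
  rw [derivWithin_congr hf (hf hc)]
  exact hd.hasDerivWithinAt.derivWithin (uniqueDiffOn_Icc zero_lt_one c hc)

/-- Comparability of a positive continuous function on the unit interval: if `G : [0,1] → ℝ` is
continuous and everywhere positive, one constant `Λ` gives `G s ≤ Λ * G s'` for all `s, s'`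
(extreme value theorem on the compact nonempty space `unitInterval`, `Λ = max G / min G`). -/
theorem exists_le_mul_of_continuous_pos {G : unitInterval → ℝ} (hG : Continuous G)
    (hpos : ∀ s, 0 < G s) : ∃ Λ : ℝ, ∀ s s' : unitInterval, G s ≤ Λ * G s' := by
  obtain ⟨s₀, -, hmin⟩ := isCompact_univ.exists_isMinOn Set.univ_nonempty hG.continuousOn
  obtain ⟨s₁, -, hmax⟩ := isCompact_univ.exists_isMaxOn Set.univ_nonempty hG.continuousOn
  have h0 : 0 < G s₀ := hpos s₀
  refine ⟨G s₁ / G s₀, fun s s' => ?_⟩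
  have h1 : G s ≤ G s₁ := hmax (Set.mem_univ s)
  have h2 : G s₀ ≤ G s' := hmin (Set.mem_univ s')
  calc G s ≤ G s₁ := h1
    _ = G s₁ / G s₀ * G s₀ := (div_mul_cancel₀ _ h0.ne').symm
    _ ≤ G s₁ / G s₀ * G s' :=
        mul_le_mul_of_nonneg_left h2 (div_nonneg ((hpos s).le.trans h1) h0.le)

/-- **INFRASTRUCTURE: comparability at a FIXED mesh is automatic.**  For `η ≠ 0` the gradient size
`q ↦ |Dρ| + |Dc|` is continuous on `[0,1]²` (`P` is a polynomial there, `exists_contDiff_eq_P`;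
`Dρ`, `Dc` are the partials of that polynomial, `derivWithin` on `Icc` having unique
derivatives), so along a continuous path in the square on which it is positive it is comparable up
to one constant. -/
theorem stub_comparability_fixedMesh (k m : ℕ) (F : Fin m → Quad (Set.univ : Set ℂ)) {η : ℝ}
    (hη : η ≠ 0) (γ : unitInterval → ℝ × ℝ) (hγ : Continuous γ)
    (hsq : ∀ s, γ s ∈ Set.Icc (0 : ℝ) 1 ×ˢ Set.Icc (0 : ℝ) 1)
    (hpos : ∀ s, 0 < |Dρ k m F η (γ s)| + |Dc k m F η (γ s)|) :
    ∃ Λ : ℝ, ∀ s s' : unitInterval,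
      |Dρ k m F η (γ s)| + |Dc k m F η (γ s)| ≤ Λ * (|Dρ k m F η (γ s')| + |Dc k m F η (γ s')|) := by
  obtain ⟨Φ, hΦ, hPΦ⟩ := exists_contDiff_eq_P k m F hη
  have hdiff : Differentiable ℝ Φ := hΦ.differentiable one_ne_zero
  -- the gradient size agrees on the square with a continuous function of the parameter point
  have hDρ : ∀ q ∈ Set.Icc (0 : ℝ) 1 ×ˢ Set.Icc (0 : ℝ) 1, Dρ k m F η q = fderiv ℝ Φ q (1, 0) := by
    rintro ⟨ρ, c⟩ ⟨hρ, hc⟩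
    exact derivWithin_eq_fderiv_fst (hdiff (ρ, c)) hρ fun ρ' hρ' => hPΦ ρ' hρ' c hc
  have hDc : ∀ q ∈ Set.Icc (0 : ℝ) 1 ×ˢ Set.Icc (0 : ℝ) 1, Dc k m F η q = fderiv ℝ Φ q (0, 1) := by
    rintro ⟨ρ, c⟩ ⟨hρ, hc⟩
    exact derivWithin_eq_fderiv_snd (hdiff (ρ, c)) hc fun c' hc' => hPΦ ρ hρ c' hc'
  have hcf : Continuous (fderiv ℝ Φ) := hΦ.continuous_fderiv one_ne_zero
  have hcont : Continuous fun s : unitInterval =>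
      |fderiv ℝ Φ (γ s) (1, 0)| + |fderiv ℝ Φ (γ s) (0, 1)| :=
    (((hcf.comp hγ).clm_apply continuous_const).abs).add
      (((hcf.comp hγ).clm_apply continuous_const).abs)
  have hG : ∀ s, |Dρ k m F η (γ s)| + |Dc k m F η (γ s)| =
      |fderiv ℝ Φ (γ s) (1, 0)| + |fderiv ℝ Φ (γ s) (0, 1)| := fun s => by
    rw [hDρ (γ s) (hsq s), hDc (γ s) (hsq s)]
  obtain ⟨Λ, hΛ⟩ := exists_le_mul_of_continuous_pos hcont fun s => (hG s) ▸ hpos s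
  exact ⟨Λ, fun s s' => by rw [hG s, hG s']; exact hΛ s s'⟩

end Summit.CriticalPhenomena.CardyFormulaZ2.Theorems.CardySelfRefinement

end
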